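import Summits.AtomisticToContinuum.BoseEinsteinCondensation.Theorems.BECHeatBathGapJastrowDobrushinRungModelDobrushin

/-!
# Crux `ParticleTensorisation` (stmt-AtomisticToContinuum-14367) — `Negative/`:
# private wells, spin read-out and the Curie–Weiss reference weight (file W1)

Toward `¬ stub_posdefDressing`: particle `k` is confined to two private cubic wells of side `a`,
`W⁺_k = (1, 1 + k/N, 1) + (0,a)³` and `W⁻_k = (3/2, 1 + k/N, 1) + (0,a)³`, inside the box `Λ₃`;
the spin read-out is `s(x) = 1` if `x₀ < 5/4` and `-1` otherwise; the reference ("undressed")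
weight is the Curie–Weiss weight on the well labels,
`w(X) = ∏_k χ_k(x_k) · exp(b (M(X)² - N²)/2)`, `M = ∑_k s(x_k)`, `χ_k = 1_{W⁺_k ∪ W⁻_k}`,
and it factorises as `w = B_j π_j` with the one-site weight
`π_j = χ_j(x_j) exp(b (s(x_j) M_j - (N-1)))`, `M_j = ∑_{k ≠ j} s(x_k)`, as the abstract Dobrushin
theorem `JastrowDobrushin.integral_sub_mean_sq_mul_w_le` wants. This file: the elementary algebra,
measurability and bounds of these objects, and the volume `a³` of a cell. Rung style: all objects
are variables with defining hypotheses (`hq⁺, hq⁻, hWp, hWm, hs, hχ, hM, hMj, hw, hπ, hB`).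
-/

noncomputable section

namespace Summit.AtomisticToContinuum.BoseEinsteinCondensation.Theorems.PosdefDressingNeg

open MeasureTheory Function Finset Set
open scoped ENNReal
open Literature.MathematicalPhysics.QuantumManyBody.BoseGas

/-! ### Cells and their volume -/

/-- `|q + (0,a)³| = a³` in `ℝ³`. [folklore] -/
theorem volume_cell (q : Fin 3 → ℝ) (a : ℝ) :
    volume {x : Space | ∀ i, x i ∈ Ioo (q i) (q i + a)} = ENNReal.ofReal a ^ 3 := by
  have h : {x : Space | ∀ i, x i ∈ Ioo (q i) (q i + a)} =
      (@WithLp.ofLp 2 (Fin 3 → ℝ)) ⁻¹' (Set.univ.pi fun i => Ioo (q i) (q i + a)) := by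
    ext x; simp
  rw [h, (PiLp.volume_preserving_ofLp (Fin 3)).measure_preimage
    (MeasurableSet.univ_pi fun _ => measurableSet_Ioo).nullMeasurableSet, volume_pi_pi]
  simp only [Real.volume_Ioo, add_sub_cancel_left, prod_const, card_univ, Fintype.card_fin]

/-- A cell is measurable. [folklore] -/
theorem measurableSet_cell (q : Fin 3 → ℝ) (a : ℝ) :
    MeasurableSet {x : Space | ∀ i, x i ∈ Ioo (q i) (q i + a)} := by
  have : {x : Space | ∀ i, x i ∈ Ioo (q i) (q i + a)} =
      ⋂ i : Fin 3, (fun x : Space => x i) ⁻¹' Ioo (q i) (q i + a) := by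
    ext x; simp
  rw [this]
  exact MeasurableSet.iInter fun i => measurableSet_Ioo.preimage (by fun_prop)

/-- A cell with `0 < q i`, `q i + a ≤ L` lies in the box `Λ_L`. [folklore] -/
theorem cell_subset_box (q : Fin 3 → ℝ) {a L : ℝ} (hq : ∀ i, 0 < q i) (hqa : ∀ i, q i + a ≤ L) :
    {x : Space | ∀ i, x i ∈ Ioo (q i) (q i + a)} ⊆ box L := by
  intro x hx i
  exact ⟨(hq i).trans (hx i).1, (hx i).2.trans_le (hqa i)⟩

section Model

variable {N : ℕ} {a b : ℝ}
variable {qp qm : Fin N → Fin 3 → ℝ} {Wp Wm : Fin N → Set Space} {s : Space → ℝ}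
  {χ : Fin N → Space → ℝ} {M : (Fin N → Space) → ℝ} {Mj : Fin N → (Fin N → Space) → ℝ}
  {w : (Fin N → Space) → ℝ} {π B : Fin N → (Fin N → Space) → ℝ}

/-! ### The spin read-out -/

/-- `s² = 1`. [folklore] -/
theorem s_sq (hs : ∀ x, s x = if x 0 < 5 / 4 then 1 else -1) (x : Space) : s x ^ 2 = 1 := by
  rw [hs]; split_ifs <;> norm_num

/-- `|s| ≤ 1`. [folklore] -/
theorem abs_s_le (hs : ∀ x, s x = if x 0 < 5 / 4 then 1 else -1) (x : Space) : |s x| ≤ 1 := by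
  rw [hs]; split_ifs <;> norm_num

/-- `|s y - s y'| ≤ 2`. [folklore] -/
theorem abs_s_sub_s_le (hs : ∀ x, s x = if x 0 < 5 / 4 then 1 else -1) (y y' : Space) :
    |s y - s y'| ≤ 2 := by
  have h1 := abs_s_le hs y
  have h2 := abs_s_le hs y'
  calc |s y - s y'| ≤ |s y| + |s y'| := abs_sub _ _
    _ ≤ 2 := by linarith

/-- `s` is measurable. [folklore] -/
theorem measurable_s (hs : ∀ x, s x = if x 0 < 5 / 4 then 1 else -1) : Measurable s := by
  have h : s = fun x : Space => if x 0 < 5 / 4 then (1 : ℝ) else -1 := funext hs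
  rw [h]
  refine Measurable.ite ?_ measurable_const measurable_const
  exact measurableSet_lt (by fun_prop) measurable_const

/-- `s = 1` on a plus-well (`x₀ < 1 + a ≤ 5/4`). [folklore] -/
theorem s_of_mem_Wp (hs : ∀ x, s x = if x 0 < 5 / 4 then 1 else -1)
    (hqp : ∀ k, qp k = ![1, 1 + (k : ℝ) / N, 1])
    (hWp : ∀ k, Wp k = {x : Space | ∀ i, x i ∈ Ioo (qp k i) (qp k i + a)}) (ha : a ≤ 1 / 4)
    {k : Fin N} {x : Space} (hx : x ∈ Wp k) : s x = 1 := by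
  rw [hWp] at hx
  have h0 := (hx 0).2
  simp only [hqp, Matrix.cons_val_zero] at h0
  rw [hs, if_pos (by linarith)]

/-- `s = -1` on a minus-well (`x₀ > 3/2`). [folklore] -/
theorem s_of_mem_Wm (hs : ∀ x, s x = if x 0 < 5 / 4 then 1 else -1)
    (hqm : ∀ k, qm k = ![3 / 2, 1 + (k : ℝ) / N, 1])
    (hWm : ∀ k, Wm k = {x : Space | ∀ i, x i ∈ Ioo (qm k i) (qm k i + a)})
    {k : Fin N} {x : Space} (hx : x ∈ Wm k) : s x = -1 := by
  rw [hWm] at hx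
  have h0 := (hx 0).1
  simp only [hqm, Matrix.cons_val_zero] at h0
  rw [hs, if_neg (by linarith)]

/-- The two wells of a particle are disjoint. [folklore] -/
theorem disjoint_Wp_Wm (hqp : ∀ k, qp k = ![1, 1 + (k : ℝ) / N, 1])
    (hqm : ∀ k, qm k = ![3 / 2, 1 + (k : ℝ) / N, 1])
    (hWp : ∀ k, Wp k = {x : Space | ∀ i, x i ∈ Ioo (qp k i) (qp k i + a)})
    (hWm : ∀ k, Wm k = {x : Space | ∀ i, x i ∈ Ioo (qm k i) (qm k i + a)}) (ha : a ≤ 1 / 4)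
    (k l : Fin N) : Disjoint (Wp k) (Wm l) := by
  rw [Set.disjoint_left]
  intro x hxp hxm
  rw [hWp] at hxp
  rw [hWm] at hxm
  have h1 := (hxp 0).2
  have h2 := (hxm 0).1
  simp only [hqp, hqm, Matrix.cons_val_zero] at h1 h2
  linarith

/-! ### The well indicator `χ_k` -/

/-- `χ_k ∈ {0, 1}`, hence `0 ≤ χ_k ≤ 1`. [folklore] -/
theorem χ_mem (hχ : ∀ k x, χ k x = (Wp k ∪ Wm k).indicator (fun _ => (1 : ℝ)) x) (k : Fin N) (x : Space) :
    0 ≤ χ k x ∧ χ k x ≤ 1 := by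
  rw [hχ]
  by_cases h : x ∈ Wp k ∪ Wm k
  · rw [Set.indicator_of_mem h]; norm_num
  · rw [Set.indicator_of_notMem h]; norm_num

/-- `χ_k` is measurable. [folklore] -/
theorem measurable_χ (hWp : ∀ k, Wp k = {x : Space | ∀ i, x i ∈ Ioo (qp k i) (qp k i + a)})
    (hWm : ∀ k, Wm k = {x : Space | ∀ i, x i ∈ Ioo (qm k i) (qm k i + a)})
    (hχ : ∀ k x, χ k x = (Wp k ∪ Wm k).indicator (fun _ => (1 : ℝ)) x) (k : Fin N) : Measurable (χ k) := by
  have h : χ k = (Wp k ∪ Wm k).indicator (fun _ => (1 : ℝ)) := funext (hχ k)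
  rw [h]
  refine measurable_const.indicator ?_
  rw [hWp, hWm]
  exact (measurableSet_cell _ _).union (measurableSet_cell _ _)

/-- Products of well indicators lie in `[0, 1]`. [folklore] -/
theorem prod_χ_mem (hχ : ∀ k x, χ k x = (Wp k ∪ Wm k).indicator (fun _ => (1 : ℝ)) x) (t : Finset (Fin N))
    (X : Fin N → Space) : 0 ≤ ∏ k ∈ t, χ k (X k) ∧ ∏ k ∈ t, χ k (X k) ≤ 1 :=
  ⟨prod_nonneg fun k _ => (χ_mem hχ k _).1,
    prod_le_one (fun k _ => (χ_mem hχ k _).1) fun k _ => (χ_mem hχ k _).2⟩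

/-! ### The magnetisations `M`, `M_j` -/

/-- `|M_j| ≤ N - 1`. [folklore] -/
theorem abs_Mj_le (hs : ∀ x, s x = if x 0 < 5 / 4 then 1 else -1)
    (hMj : ∀ j X, Mj j X = ∑ k ∈ univ.erase j, s (X k)) (j : Fin N) (X : Fin N → Space) :
    |Mj j X| ≤ (N : ℝ) - 1 := by
  rw [hMj]
  refine (abs_sum_le_sum_abs _ _).trans ?_
  calc ∑ k ∈ univ.erase j, |s (X k)| ≤ ∑ _k ∈ univ.erase j, (1 : ℝ) :=
        sum_le_sum fun k _ => abs_s_le hs _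
    _ = (N : ℝ) - 1 := by
        rw [sum_const, nsmul_eq_mul, mul_one, card_erase_of_mem (mem_univ j), card_univ,
          Fintype.card_fin, Nat.cast_sub (Nat.one_le_iff_ne_zero.mpr (Fin.pos j).ne'),
          Nat.cast_one]

/-- `|M| ≤ N`. [folklore] -/
theorem abs_M_le (hs : ∀ x, s x = if x 0 < 5 / 4 then 1 else -1)
    (hM : ∀ X, M X = ∑ k, s (X k)) (X : Fin N → Space) : |M X| ≤ N := by
  rw [hM]
  refine (abs_sum_le_sum_abs _ _).trans ?_
  calc ∑ k, |s (X k)| ≤ ∑ _k : Fin N, (1 : ℝ) := sum_le_sum fun k _ => abs_s_le hs _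
    _ = N := by simp

/-- `M = M_j + s(x_j)`. [folklore] -/
theorem M_eq_Mj_add (hM : ∀ X, M X = ∑ k, s (X k))
    (hMj : ∀ j X, Mj j X = ∑ k ∈ univ.erase j, s (X k)) (j : Fin N) (X : Fin N → Space) :
    M X = Mj j X + s (X j) := by
  rw [hM, hMj, sum_erase_add _ _ (mem_univ j)]

/-- `M_j` does not see the `j`-th coordinate. [folklore] -/
theorem Mj_update_self (hMj : ∀ j X, Mj j X = ∑ k ∈ univ.erase j, s (X k)) (j : Fin N)
    (X : Fin N → Space) (y : Space) : Mj j (update X j y) = Mj j X := by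
  rw [hMj, hMj]
  exact sum_congr rfl fun k hk => by rw [update_of_ne (ne_of_mem_erase hk)]

/-- Moving particle `k ≠ j` changes `M_j` by `s(y) - s(x_k)`. [folklore] -/
theorem Mj_update_of_ne (hMj : ∀ j X, Mj j X = ∑ k ∈ univ.erase j, s (X k)) {j k : Fin N}
    (hjk : j ≠ k) (X : Fin N → Space) (y : Space) :
    Mj j (update X k y) = Mj j X - s (X k) + s y := by
  rw [hMj, hMj]
  have hk : k ∈ univ.erase j := mem_erase.mpr ⟨hjk.symm, mem_univ k⟩
  rw [← add_sum_erase _ _ hk, ← add_sum_erase (univ.erase j) _ hk, update_self]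
  have : ∑ x ∈ (univ.erase j).erase k, s (update X k y x) = ∑ x ∈ (univ.erase j).erase k, s (X x) :=
    sum_congr rfl fun i hi => by rw [update_of_ne (ne_of_mem_erase hi)]
  rw [this]
  ring

/-- `M`, `M_j` are measurable. [folklore] -/
theorem measurable_M (hs : ∀ x, s x = if x 0 < 5 / 4 then 1 else -1)
    (hM : ∀ X, M X = ∑ k, s (X k)) : Measurable M := by
  have h : M = fun X => ∑ k, s (X k) := funext hM
  rw [h]
  exact Finset.measurable_sum _ fun k _ => (measurable_s hs).comp (measurable_pi_apply k)

/-- `M_j` is measurable. [folklore] -/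
theorem measurable_Mj (hs : ∀ x, s x = if x 0 < 5 / 4 then 1 else -1)
    (hMj : ∀ j X, Mj j X = ∑ k ∈ univ.erase j, s (X k)) (j : Fin N) : Measurable (Mj j) := by
  have h : Mj j = fun X => ∑ k ∈ univ.erase j, s (X k) := funext (hMj j)
  rw [h]
  exact Finset.measurable_sum _ fun k _ => (measurable_s hs).comp (measurable_pi_apply k)

/-! ### The weights `w`, `π_j`, `B_j` -/

/-- The one-site weight `π_j` is measurable with values in `[0, 1]` (for `0 ≤ b`). [folklore] -/
theorem model_hπ' (hb : 0 ≤ b) (hs : ∀ x, s x = if x 0 < 5 / 4 then 1 else -1)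
    (hWp : ∀ k, Wp k = {x : Space | ∀ i, x i ∈ Ioo (qp k i) (qp k i + a)})
    (hWm : ∀ k, Wm k = {x : Space | ∀ i, x i ∈ Ioo (qm k i) (qm k i + a)})
    (hχ : ∀ k x, χ k x = (Wp k ∪ Wm k).indicator (fun _ => (1 : ℝ)) x)
    (hMj : ∀ j X, Mj j X = ∑ k ∈ univ.erase j, s (X k))
    (hπ : ∀ j X, π j X = χ j (X j) * Real.exp (b * (s (X j) * Mj j X - ((N : ℝ) - 1)))) (j : Fin N) :
    Measurable (π j) ∧ ∀ X, 0 ≤ π j X ∧ π j X ≤ 1 := by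
  refine ⟨?_, fun X => ?_⟩
  · have h : π j = fun X => χ j (X j) * Real.exp (b * (s (X j) * Mj j X - ((N : ℝ) - 1))) :=
      funext (hπ j)
    rw [h]
    exact ((measurable_χ hWp hWm hχ j).comp (measurable_pi_apply j)).mul
      (Real.measurable_exp.comp ((((measurable_s hs).comp (measurable_pi_apply j)).mul
        (measurable_Mj hs hMj j)).sub measurable_const |>.const_mul b))
  · have hχ01 := χ_mem hχ j (X j)
    have hexp : Real.exp (b * (s (X j) * Mj j X - ((N : ℝ) - 1))) ≤ 1 := by
      rw [Real.exp_le_one_iff]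
      refine mul_nonpos_of_nonneg_of_nonpos hb ?_
      have h1 : s (X j) * Mj j X ≤ |s (X j)| * |Mj j X| := by
        rw [← abs_mul]; exact le_abs_self _
      have h2 : |s (X j)| * |Mj j X| ≤ 1 * ((N : ℝ) - 1) :=
        mul_le_mul (abs_s_le hs _) (abs_Mj_le hs hMj j X) (abs_nonneg _) zero_le_one
      linarith
    rw [hπ]
    exact ⟨mul_nonneg hχ01.1 (Real.exp_pos _).le,
      mul_le_one₀ hχ01.2 (Real.exp_pos _).le hexp⟩

/-- The complementary weight `B_j` is measurable, in `[0, 1]`, and blind to `x_j`. [folklore] -/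
theorem model_hB' (hb : 0 ≤ b) (hs : ∀ x, s x = if x 0 < 5 / 4 then 1 else -1)
    (hWp : ∀ k, Wp k = {x : Space | ∀ i, x i ∈ Ioo (qp k i) (qp k i + a)})
    (hWm : ∀ k, Wm k = {x : Space | ∀ i, x i ∈ Ioo (qm k i) (qm k i + a)})
    (hχ : ∀ k x, χ k x = (Wp k ∪ Wm k).indicator (fun _ => (1 : ℝ)) x)
    (hMj : ∀ j X, Mj j X = ∑ k ∈ univ.erase j, s (X k))
    (hB : ∀ j X, B j X = (∏ k ∈ univ.erase j, χ k (X k)) *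
      Real.exp (b * ((Mj j X) ^ 2 - ((N : ℝ) - 1) ^ 2) / 2)) (j : Fin N) :
    Measurable (B j) ∧ (∀ X, 0 ≤ B j X ∧ B j X ≤ 1) ∧ ∀ X y, B j (update X j y) = B j X := by
  refine ⟨?_, fun X => ?_, fun X y => ?_⟩
  · have h : B j = fun X => (∏ k ∈ univ.erase j, χ k (X k)) *
        Real.exp (b * ((Mj j X) ^ 2 - ((N : ℝ) - 1) ^ 2) / 2) := funext (hB j)
    rw [h]
    refine (Finset.measurable_prod _ fun k _ =>
      (measurable_χ hWp hWm hχ k).comp (measurable_pi_apply k)).mul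
      (Real.measurable_exp.comp ?_)
    exact (((measurable_Mj hs hMj j).pow_const 2).sub measurable_const).const_mul b |>.div_const 2
  · have hP := prod_χ_mem hχ (univ.erase j) X
    have hexp : Real.exp (b * ((Mj j X) ^ 2 - ((N : ℝ) - 1) ^ 2) / 2) ≤ 1 := by
      rw [Real.exp_le_one_iff]
      refine div_nonpos_of_nonpos_of_nonneg (mul_nonpos_of_nonneg_of_nonpos hb ?_) (by norm_num)
      have h1 := abs_Mj_le hs hMj j X
      have h2 : (Mj j X) ^ 2 ≤ ((N : ℝ) - 1) ^ 2 := by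
        rw [← sq_abs (Mj j X)]
        exact pow_le_pow_left₀ (abs_nonneg _) h1 2
      linarith
    rw [hB]
    exact ⟨mul_nonneg hP.1 (Real.exp_pos _).le, mul_le_one₀ hP.2 (Real.exp_pos _).le hexp⟩
  · rw [hB, hB, Mj_update_self hMj]
    congr 1
    exact prod_congr rfl fun k hk => by rw [update_of_ne (ne_of_mem_erase hk)]

/-- **Factorisation** `w = B_j π_j` of the Curie–Weiss-on-wells weight. [folklore] -/
theorem w_eq_B_mul_π (hs : ∀ x, s x = if x 0 < 5 / 4 then 1 else -1)
    (hM : ∀ X, M X = ∑ k, s (X k)) (hMj : ∀ j X, Mj j X = ∑ k ∈ univ.erase j, s (X k))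
    (hw : ∀ X, w X = (∏ k, χ k (X k)) * Real.exp (b * ((M X) ^ 2 - (N : ℝ) ^ 2) / 2))
    (hπ : ∀ j X, π j X = χ j (X j) * Real.exp (b * (s (X j) * Mj j X - ((N : ℝ) - 1))))
    (hB : ∀ j X, B j X = (∏ k ∈ univ.erase j, χ k (X k)) *
      Real.exp (b * ((Mj j X) ^ 2 - ((N : ℝ) - 1) ^ 2) / 2)) (j : Fin N) (X : Fin N → Space) :
    w X = B j X * π j X := by
  rw [hw, hB, hπ, M_eq_Mj_add hM hMj j X, ← mul_prod_erase _ _ (mem_univ j)]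
  have hsq := s_sq hs (X j)
  have hexp : Real.exp (b * ((Mj j X + s (X j)) ^ 2 - (N : ℝ) ^ 2) / 2) =
      Real.exp (b * ((Mj j X) ^ 2 - ((N : ℝ) - 1) ^ 2) / 2) *
        Real.exp (b * (s (X j) * Mj j X - ((N : ℝ) - 1))) := by
    rw [← Real.exp_add]
    congr 1
    have : (Mj j X + s (X j)) ^ 2 = Mj j X ^ 2 + 2 * (s (X j) * Mj j X) + s (X j) ^ 2 := by ring
    rw [this, hsq]
    ring
  rw [hexp]
  ring

/-- `w` is measurable with values in `[0, 1]` (for `0 ≤ b`). [folklore] -/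
theorem w_mem (hb : 0 ≤ b) (hs : ∀ x, s x = if x 0 < 5 / 4 then 1 else -1)
    (hWp : ∀ k, Wp k = {x : Space | ∀ i, x i ∈ Ioo (qp k i) (qp k i + a)})
    (hWm : ∀ k, Wm k = {x : Space | ∀ i, x i ∈ Ioo (qm k i) (qm k i + a)})
    (hχ : ∀ k x, χ k x = (Wp k ∪ Wm k).indicator (fun _ => (1 : ℝ)) x)
    (hM : ∀ X, M X = ∑ k, s (X k))
    (hw : ∀ X, w X = (∏ k, χ k (X k)) * Real.exp (b * ((M X) ^ 2 - (N : ℝ) ^ 2) / 2)) :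
    Measurable w ∧ ∀ X, 0 ≤ w X ∧ w X ≤ 1 := by
  refine ⟨?_, fun X => ?_⟩
  · have h : w = fun X => (∏ k, χ k (X k)) * Real.exp (b * ((M X) ^ 2 - (N : ℝ) ^ 2) / 2) :=
      funext hw
    rw [h]
    refine (Finset.measurable_prod _ fun k _ =>
      (measurable_χ hWp hWm hχ k).comp (measurable_pi_apply k)).mul (Real.measurable_exp.comp ?_)
    exact (((measurable_M hs hM).pow_const 2).sub measurable_const).const_mul b |>.div_const 2
  · have hP := prod_χ_mem hχ univ X
    have hexp : Real.exp (b * ((M X) ^ 2 - (N : ℝ) ^ 2) / 2) ≤ 1 := by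
      rw [Real.exp_le_one_iff]
      refine div_nonpos_of_nonpos_of_nonneg (mul_nonpos_of_nonneg_of_nonpos hb ?_) (by norm_num)
      have h1 := abs_M_le hs hM X
      have h2 : (M X) ^ 2 ≤ (N : ℝ) ^ 2 := by
        rw [← sq_abs (M X)]
        exact pow_le_pow_left₀ (abs_nonneg _) h1 2
      linarith
    rw [hw]
    exact ⟨mul_nonneg hP.1 (Real.exp_pos _).le, mul_le_one₀ hP.2 (Real.exp_pos _).le hexp⟩

/-- A lower bound for `w` on its support: `w ≥ e^{-bN²}` where all particles sit in their wells.
[folklore] -/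
theorem exp_le_w (hb : 0 ≤ b) (hχ : ∀ k x, χ k x = (Wp k ∪ Wm k).indicator (fun _ => (1 : ℝ)) x)
    (hw : ∀ X, w X = (∏ k, χ k (X k)) * Real.exp (b * ((M X) ^ 2 - (N : ℝ) ^ 2) / 2))
    {X : Fin N → Space} (hX : ∀ k, X k ∈ Wp k ∪ Wm k) :
    Real.exp (-(b * (N : ℝ) ^ 2)) ≤ w X := by
  have hprod : ∏ k, χ k (X k) = 1 := prod_eq_one fun k _ => by rw [hχ, Set.indicator_of_mem (hX k)]
  rw [hw, hprod, one_mul]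
  refine Real.exp_le_exp.mpr ?_
  have : 0 ≤ b * (M X) ^ 2 := mul_nonneg hb (sq_nonneg _)
  nlinarith

/-- Off its support `w` vanishes: if some particle is outside its wells then `w = 0`. [folklore] -/
theorem w_eq_zero (hχ : ∀ k x, χ k x = (Wp k ∪ Wm k).indicator (fun _ => (1 : ℝ)) x)
    (hw : ∀ X, w X = (∏ k, χ k (X k)) * Real.exp (b * ((M X) ^ 2 - (N : ℝ) ^ 2) / 2))
    {X : Fin N → Space} {k : Fin N} (hX : X k ∉ Wp k ∪ Wm k) : w X = 0 := by
  rw [hw, prod_eq_zero (mem_univ k) (by rw [hχ, Set.indicator_of_notMem hX]), zero_mul]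

end Model

end Summit.AtomisticToContinuum.BoseEinsteinCondensation.Theorems.PosdefDressingNeg

end
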